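import Summits.BirchSwinnertonDyer.BirchSwinnertonDyer.Theorems.RamifiedSevenEllipticUnitsStrictControlTwistDescent
import Summits.BirchSwinnertonDyer.BirchSwinnertonDyer.Theorems.RamifiedSevenEllipticUnitsStrictControlCastellaBridge
import Summits.BirchSwinnertonDyer.BirchSwinnertonDyer.Theorems.RamifiedSevenEllipticUnitsStrictControlDescent
import Literature.NumberTheory.EllipticCurves.ArtinFormalismQuadraticLocalProofs
import HarnessLib

set_option linter.dupNamespace false
set_option autoImplicit false

/-!
# Route `RamifiedSevenEllipticUnits` (rung K7r): crux #4 `StrictControlSeven` PROVED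
# (stmt-BirchSwinnertonDyer-19145)

Cell `bsd-cm`, seat `bsd-cm-k7r-c4` (g0). HONEST FRAMING: this closes ONE crux of one route; BSD
is not proved by any of this. The crux `StrictControlSeven = ∀ W ∈ 𝒞₇, RamifiedCMStrictControlAt W 7`
(O11's typed input (R-ctrl): EXACT bottom-layer control of the STRICT anticyclotomic Selmer group at
the CM-ramified prime `7` for the class `𝒞₇ = {CM by ℚ(√−7), r_an = 1, good ordinary at 2, bad
primes ≠ 7 CM-split}`) was reduced in `…StrictControlDescent` (Euler characteristic, exact control,
the two local torsion inputs — all proved there and in its siblings) to the TWIST-DESCENT identity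

  (D) `ord₇ #Sel_𝔭(K, E[7^∞]) = ord₇ #Sel_str(E/ℚ)[7^∞] + ord₇ #Sel_str(E'/ℚ)[7^∞]`

for every frame `(K, 𝔭, W', C)` of `W ∈ 𝒞₇` at `7` (`K = ℚ(√−7)`, `𝔭² = (7)`, `W' = C • W^{(−7)}`)
with `Sel_𝔭(K, E[7^∞])` finite. This file proves (D) and hence the crux:

* `#Sel_𝔭(K, E[7^∞]) = #T_K`, `T_K` the everywhere-strict subgroup of `H¹(K, E[7^∞])`
  (`…CastellaBridge.natCard_selmerAcBase_eq_natCard_iInf`; `𝔭` is the unique prime above the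
  ramified `7`, `eq_of_mem_of_dvd_discr_of_finrank_eq_two`; `K` is totally complex);
* `#T_K = #Sel_str(E/ℚ)[7^∞] · #Sel_str(E^{(d_K)}/ℚ)[7^∞]` — the strict `±`-decomposition at the odd
  prime `7` (`…TwistDescent.natCard_iInf_selmerLocalKerPrimaryTorsion_eq_mul`, Dokchitser–Dokchitser
  Lemma 4.14 run for the strict groups, `K = ℚ(θ)`, `θ² = d_K`);
* `#Sel_str(E^{(d_K)}/ℚ)[7^∞] = #Sel_str(E'/ℚ)[7^∞]` for the frame twin `W' = C • W^{(d_K)}`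
  (`…StrictLocalIso.natCard_strictSelmerPInfty_eq_of_variableChange`);
* `ord₇` of a non-zero product is additive.

## Main statements

* `twistDescent_identity` — (D) for every frame of every `W ∈ 𝒞₇` (indeed for every framed CM pair
  at `7`; the class hypothesis is not used in (D) itself).
* `StrictControlSeven_proof :
    Summit.BirchSwinnertonDyer.BirchSwinnertonDyer.Theses.RamifiedSevenEllipticUnits.StrictControlSeven`.

References: [DokchitserDokchitserAnnals2010] Lemma 4.14 (proof); [Castella2018] Def. 2.2,
Thm. 2.3 (arXiv:1704.06608 p. 5); [GreenbergLNM1716] §2–4; [BurungaleKobayashiNakamuraOta2026]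
§3 (arXiv:2608.06879; the ramified setting — nothing of it is used as a hypothesis here).
-/

noncomputable section

open scoped Classical

open WeierstrassCurve NumberField IsDedekindDomain Field
  Literature.NumberTheory.EllipticCurves
  Literature.NumberTheory.EllipticCurves.Rank1Residual
  Literature.NumberTheory.GaloisRepresentations
  Summit.BirchSwinnertonDyer.Rank1Residual
  Summit.BirchSwinnertonDyer.Rank1Residual.Additive
  Summit.BirchSwinnertonDyer.Rank1Residual.X11b
  Summit.BirchSwinnertonDyer.Rank1Residual.X11b.AcSelmer

namespace Summit.BirchSwinnertonDyer.BirchSwinnertonDyer.Theorems.RamifiedSevenEllipticUnits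

/-- **(D) The twist-descent identity for the strict `7^∞`-Selmer groups of a framed CM pair at `7`.**
For `W/ℚ` elliptic, a frame `(K, 𝔭, W', C)` at `p = 7` (`X12.O11.IsFrame`: `K` the imaginary
quadratic CM field with `d_K = d(j(W))`, `7 ∣ d_K` ramified, `𝔭 ∋ 7`, `W' = C • W^{(d_K)}`) and
`Sel_𝔭(K, E[7^∞])` finite:
`ord₇ #Sel_𝔭(K, E[7^∞]) = ord₇ #Sel_str(E/ℚ)[7^∞] + ord₇ #Sel_str(E'/ℚ)[7^∞]`.
Castella's group over `K` is the everywhere-strict subgroup (`natCard_selmerAcBase_eq_natCard_iInf`,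
unique prime above `7`), which the strict `±`-decomposition at the odd prime `7` splits as
`#Sel_str(E/ℚ)[7^∞] · #Sel_str(E^{(d_K)}/ℚ)[7^∞]` (`natCard_iInf_selmerLocalKerPrimaryTorsion_eq_mul`),
and `E^{(d_K)} ≅ E'` over `ℚ` (`natCard_strictSelmerPInfty_eq_of_variableChange`).
[cite: DokchitserDokchitserAnnals2010, Lemma 4.14 (proof)] [cite: Castella2018, Def. 2.2 (arXiv:1704.06608 p. 5)] -/
theorem twistDescent_identity (W : WeierstrassCurve ℚ) [W.IsElliptic] [Fact (Nat.Prime 7)]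
    (K : Type) [Field K] [NumberField K] (𝔭 : HeightOneSpectrum (𝓞 K))
    (W' : WeierstrassCurve ℚ) (C : VariableChange ℚ) (hF : X12.O11.IsFrame W 7 K 𝔭 W' C)
    (hfin : Finite (selmerAcBase (W.baseChange K) 7 𝔭 ∅)) :
    padicValNat 7 (Nat.card (selmerAcBase (W.baseChange K) 7 𝔭 ∅)) =
      padicValNat 7 (Nat.card ↥(strictSelmerPInfty W 7)) +
        padicValNat 7 (Nat.card ↥(strictSelmerPInfty W' 7)) := by
  have hK : IsImaginaryQuadratic K := hF.2.2.2.1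
  have hdisc : NumberField.discr K = cmFieldDiscrOfJ W.j := hF.2.2.2.2.1
  have h𝔭 : ((7 : ℕ) : 𝓞 K) ∈ 𝔭.asIdeal := hF.2.2.2.2.2.1
  have hW' : C • W.quadraticTwist ((cmFieldDiscrOfJ W.j : ℤ) : ℚ) = W' := hF.2.2.2.2.2.2
  have hram : (7 : ℤ) ∣ NumberField.discr K := by
    rw [hdisc]
    exact hF.2.1
  haveI : IsTotallyComplex K := hK.2
  haveI : (W.baseChange K).IsElliptic := by rw [baseChange]; infer_instance
  -- `𝔭` is the only prime of `K` above the ramified `7`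
  have huniq : ∀ v : HeightOneSpectrum (𝓞 K), ((7 : ℕ) : 𝓞 K) ∈ v.asIdeal → v = 𝔭 := fun v hv ↦
    eq_of_mem_of_dvd_discr_of_finrank_eq_two hK.1 Fact.out hram hv h𝔭
  -- `K = ℚ(θ)`, `θ² = d_K`
  obtain ⟨θ, hθ, hθsq⟩ := exists_sq_eq_discr_not_mem_range K hK.1
  rw [hdisc] at hθsq
  -- the three identities
  have hbridge := natCard_selmerAcBase_eq_natCard_iInf (W.baseChange K) 7 𝔭 huniq
  have hcount := natCard_iInf_selmerLocalKerPrimaryTorsion_eq_mul W K hK.1 hθ hθsq 7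
    (by decide) h𝔭
  have htwin : Nat.card ↥(strictSelmerPInfty (W.quadraticTwist ((cmFieldDiscrOfJ W.j : ℤ) : ℚ)) 7) =
      Nat.card ↥(strictSelmerPInfty W' 7) :=
    natCard_strictSelmerPInfty_eq_of_variableChange 7 hW'
  rw [hbridge, hcount, htwin]
  have hne : Nat.card ↥(strictSelmerPInfty W 7) * Nat.card ↥(strictSelmerPInfty W' 7) ≠ 0 := by
    rw [← htwin, ← hcount, ← hbridge]
    haveI := hfin
    exact Nat.card_pos.ne'
  exact padicValNat.mul (left_ne_zero_of_mul hne) (right_ne_zero_of_mul hne)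

/-- **Crux #4 of rung K7r, `StrictControlSeven`, holds**: for every `W ∈ 𝒞₇` the STRICT
anticyclotomic Selmer group at the CM-ramified prime `7` satisfies EXACT bottom-layer control in the
counted form `X12.O11.RamifiedCMStrictControlAt W 7` (O11's typed input (R-ctrl), BKNO 2026 §3
setting). Assembled from `strictControlSeven_of_descent` (`…StrictControlDescent`: Euler
characteristic `#(X/TX) = p^{n₀}·#X[T]`, exact control `Sel_𝔭(K,E[7^∞]) ≅ Sel_𝔭(K_∞,E[7^∞])^Γ`
from `E(K_v)[7] = 0` at every `v` for `𝒞₇`) and the twist-descent identity (D)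
(`twistDescent_identity`). Nothing conjectural is used: the statement is about orders of Selmer
groups and holds unconditionally (both sides may be the orders of infinite groups only through the
finiteness hypothesis built into `RamifiedCMStrictControlAt`). -/
theorem StrictControlSeven_proof :
    Summit.BirchSwinnertonDyer.BirchSwinnertonDyer.Theses.RamifiedSevenEllipticUnits.StrictControlSeven :=
  strictControlSeven_of_descent fun W _ _ _ _ K _ _ 𝔭 W' _ _ C hF _ hfin ↦
    twistDescent_identity W K 𝔭 W' C hF hfin

end Summit.BirchSwinnertonDyer.BirchSwinnertonDyer.Theorems.RamifiedSevenEllipticUnits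

end
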